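import Mathlib
import Summits.ValiantsHypothesis.ValiantsHypothesis.Theorems.NewtonUnitEquationsDissociatedUniformTotalsLawCircles
import HarnessLib

/-!
# Crux `NewtonUnitEquations.DissociatedUniform` (stmt-ValiantsHypothesis-5905): fibres of a pair of sampled circles ROTATE RIGIDLY with
# the fibre index (`P_{r+2} = R_{2π/q} P_r`)

Memo `Cruxes/DissociatedUniform/NOTES-t1g8.md` §5(i): the mechanism behind the orientation dichotomy on the smooth stratum is that the pair
fibres `P_r = {a x + b (r − x)}` of two co-oriented sampled circles (any centres, radii, phases — the census families) turn with `r`: advancing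
BOTH labels by one (`x ↦ x + 1` on the first circle, `r − x ↦ r − x + 1` on the second, i.e. `r ↦ r + 2`) rotates every fibre point by the
sampling angle `2π/q` about the sum of the centres.  Hence the hull-edge normals of `P_{r+2}` are those of `P_r` turned by `2π/q`, which a
clockwise-labelled dominant third curve can follow (one class collects `≈ q²/2` vertices, `…TotalsLawSmoothPointwise`) and a counter-clockwise one
cannot (start packet for `CoOrientedClassBound` in the dominant regime, via `…TotalsLawLargeThirdPointwise`).
* `rot θ` (rotation of `ℝ²`), `trigCurve_add_one` (one label step = rotation by `2π/q` about the centre),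
* **`fibrePts_trigCurve_add_two`**: `fibrePts a b (r + 2) = (rotation by 2π/q about c₁ + c₂) '' fibrePts a b r`.
Honest label: structural lemma; no law is proved; nothing here bears on VP ≠ VNP.
[folklore: angle-addition formulas]
-/

set_option linter.dupNamespace false -- `ValiantsHypothesis.ValiantsHypothesis` (summit = problem) in every name

open scoped BigOperators
open Real

namespace Summit.ValiantsHypothesis.ValiantsHypothesis.Theorems.NewtonUnitEquationsDissociatedUniform

namespace TotalsLaw

section TrigRotation

variable {q : ℕ} [NeZero q]

/-- The rotation of the plane by the angle `θ`. -/
noncomputable def rot (θ : ℝ) (v : Fin 2 → ℝ) : Fin 2 → ℝ :=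
  ![Real.cos θ * v 0 - Real.sin θ * v 1, Real.sin θ * v 0 + Real.cos θ * v 1]

omit [NeZero q] in
/-- Rotation is additive: `rot θ (u + v) = rot θ u + rot θ v`. [folklore] -/
theorem rot_add (θ : ℝ) (u v : Fin 2 → ℝ) : rot θ (u + v) = rot θ u + rot θ v := by
  ext i; fin_cases i <;> simp [rot] <;> ring

/-- **One label step on a sampled circle is the rotation by `2π/q` about its centre.** [folklore] -/
theorem trigCurve_add_one (c₀ : Fin 2 → ℝ) (A φ : ℝ) (k : ZMod q) :
    trigCurve c₀ A φ (k + 1) = c₀ + rot (2 * π / q) (trigCurve c₀ A φ k - c₀) := by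
  have hval : (k + 1 : ZMod q).val = (k.val + 1) % q := by
    rw [show k + 1 = ((k.val + 1 : ℕ) : ZMod q) by push_cast; rw [ZMod.natCast_zmod_val], ZMod.val_natCast]
  have ec : Real.cos (φ + 2 * π * (((k.val + 1) % q : ℕ) : ℝ) / q) = Real.cos ((φ + 2 * π * (k.val : ℝ) / q) + 2 * π / q) := by
    rw [cos_phase_mod]; push_cast; ring_nf
  have es : Real.sin (φ + 2 * π * (((k.val + 1) % q : ℕ) : ℝ) / q) = Real.sin ((φ + 2 * π * (k.val : ℝ) / q) + 2 * π / q) := by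
    rw [sin_phase_mod]; push_cast; ring_nf
  unfold trigCurve
  rw [hval, add_sub_cancel_left]
  ext i
  fin_cases i
  · simp only [Fin.zero_eta, Fin.isValue, Pi.add_apply, Matrix.cons_val_zero, rot, Matrix.cons_val_one]
    rw [ec, Real.cos_add]; ring
  · simp only [Fin.mk_one, Fin.isValue, Pi.add_apply, Matrix.cons_val_one, Matrix.cons_val_zero, rot]
    rw [es, Real.sin_add]; ring

/-- Pointwise form of the fibre rotation: advancing both labels turns the fibre point about the sum of the centres. [folklore] -/
theorem trigCurve_add_one_add (c₁ c₂ : Fin 2 → ℝ) (A B φ ψ : ℝ) (x y : ZMod q) :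
    trigCurve c₁ A φ (x + 1) + trigCurve c₂ B ψ (y + 1) =
      (c₁ + c₂) + rot (2 * π / q) (trigCurve c₁ A φ x + trigCurve c₂ B ψ y - (c₁ + c₂)) := by
  rw [trigCurve_add_one, trigCurve_add_one,
    show trigCurve c₁ A φ x + trigCurve c₂ B ψ y - (c₁ + c₂) = (trigCurve c₁ A φ x - c₁) + (trigCurve c₂ B ψ y - c₂) by abel,
    rot_add]
  abel

/-- **Fibres of two sampled circles rotate rigidly with the fibre index**: `P_{r+2}` is `P_r` turned by `2π/q` about `c₁ + c₂`
(the point of `P_{r+2}` with first label `x + 1` is the turned point of `P_r` with first label `x`). [folklore] -/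
theorem fibrePts_trigCurve_add_two (c₁ c₂ : Fin 2 → ℝ) (A B φ ψ : ℝ) (r : ZMod q) :
    fibrePts (trigCurve c₁ A φ) (trigCurve c₂ B ψ) (r + 2) =
      (fun p => (c₁ + c₂) + rot (2 * π / q) (p - (c₁ + c₂))) '' fibrePts (trigCurve c₁ A φ) (trigCurve c₂ B ψ) r := by
  ext p
  simp only [fibrePts, Set.mem_range, Set.mem_image, exists_exists_eq_and]
  constructor
  · rintro ⟨x, rfl⟩
    refine ⟨x - 1, ?_⟩
    have h' := trigCurve_add_one_add c₁ c₂ A B φ ψ (x - 1) (r - x + 1)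
    rw [sub_add_cancel, show r - x + 1 + 1 = r + 2 - x by ring] at h'
    rw [show r - (x - 1) = r - x + 1 by ring]
    exact h'.symm
  · rintro ⟨x, rfl⟩
    refine ⟨x + 1, ?_⟩
    rw [show r + 2 - (x + 1) = r - x + 1 by ring]
    exact trigCurve_add_one_add c₁ c₂ A B φ ψ x (r - x)

end TrigRotation

end TotalsLaw

end Summit.ValiantsHypothesis.ValiantsHypothesis.Theorems.NewtonUnitEquationsDissociatedUniform
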